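import Mathlib
import Summits.QuantumFields.YangMills.Theorems.SelfNormalisedSkewness.Negative.SelfNormalisedSkewnessFalseOfMaxwellDominatedWindowScheme

/-!
# BC5 rung (T3 witness of weakness) for `FiniteRankMirror.X₁ = FiniteRankMirrorFloor`
# — the free Maxwell₄ instance with `J = 1`, `p = 0`, as a DECIDED SEPARATING MODEL

Tribunal-w seat `ym-mirror-bc5w-1` (2026-08-28) for item `stmt-QuantumFields-25679`
(route `route-QuantumFields-FiniteRankMirror`), answering the judge's `T3-plan-only-weak`
(verdict-FiniteRankMirror-ym-trib-j-1, candidate rung (α)).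

**Model.** The continuum free Maxwell field of `d = 4` in the normalisation of the tree's
`maxwellKernel` (`Theorems/SelfNormalisedSkewness/Negative/…MaxwellDominatedWindowScheme`, the model
that REFUTED `SelfNormalisedSkewness`, negatives `stmt-QuantumFields-18944`): the field-strength
covariance `G(x) = K(∂∂|x|⁻²)` and the Wick square `F² = F_{μν}F_{μν}` playing the plaquette energy
`dens`.  The crux's mirror form `MF_{β,L}(v) = Cov(Ṽ_v∘θ, Ṽ_v)` becomes, by Wick's rule, the tree's
two-ring functional: `MF^{Mxw}(v) = 2·maxwellRing2 v = 2 ∫∫ v(x) v(θy) tr G(x−y)G(y−x)`.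

**Rung (C's analogue, TRUE — `freeMaxwell_mirrorFloor`, sorry-free).**  With `J = 1` mode and
exponent `p = 0` (the extreme point of the hyperscaling room `p < 8`): there is `κ > 0` such that at
EVERY scale `ℓ > 0` one sup-normalised positive-time bump `w_ℓ` (`tsupport ⊆ {x₀>0} ∩ B̄(0,ℓ)`,
`0 ≤ w_ℓ ≤ 1`) has `κ ≤ MF^{Mxw}(w_ℓ)`; `freeMaxwell_finiteRankMirrorFloor` restates it in the exact
quantifier shape of the crux's floor clause (`∃ J p κ, p < 8 ∧ 0 < κ ∧ ∀ ℓ₁>0 ∃ ℓ<ℓ₁ ∃ v : Fin J → 𝓢 …`).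
The proof is the route's lever in miniature: the closed form `tr G(z)G(−z) = 96/|z|⁸`
(`trace_maxwellKernel_mul`: `tr K(h)² = 2tr h² + (tr h)²` on `Λ²ℝ⁴` and `tr (∂∂|z|⁻²)² = 48/|z|⁸`) is
homogeneous of degree `−8 = −2·dim[F²]`, so `sup|v| ≤ 1` bumps of radius `∝ ℓ` give an `ℓ`-FREE
floor (`vol² · ℓ⁻⁸ = const`) — hyperscaling saturates `p = 0`, no `ℓ^p` slack is needed, and ONE
mode suffices (finite rank `J = 1`).

**Separation (S's analogue, FALSE in the SAME model — `freeMaxwell_NT_clauseII_false`).**  The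
sub-statement `S = BalabanLadder.NT` carries clause (ii) `|Q3(f,g,h)| ≥ ε > 0` (connected three-point
floor).  In the free Maxwell model the three-point functional is `8·maxwellRing3 ≡ 0` (tree:
`maxwellRing3_eq_zero`, the SD/ASD swap), so NT's analogue fails while X₁'s analogue holds: a model in
which C's analogue is decided TRUE and S's analogue decided FALSE.  Hence no proof of `X₁ → S` can
avoid genuinely non-abelian input (the route's declared residual X₄ = clause (ii) is exactly what the
model kills), and X₁ is strictly weaker in content than S — the T3 witness of weakness, with the
route's normalisation lever (sup-normalised modes, hyperscaling exponent, finite rank) exercised.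

Why not the literal lattice `U(1)`, `β → ∞` instance: with the crux's BARE density `dens` (no `β`
prefactor) the compact-`U(1)` mirror form is `O(β⁻²) → 0` along `β → ∞`, so the typed floor is false
there for a trivial normalisation reason (GFW/judge agree); the honest abelian analogue is the
fixed-coupling free field with the lattice spacing as the only scale, whose continuum Wick value is
exactly `2·maxwellRing2` — this file.  (The lattice-regularised version over
`Literature.…curvatureGaussianField` needs Isserlis for Wick squares + `dGd*` asymptotics, not in
tree; recorded as the plan-only upgrade in the companion card.)

NOTHING HERE PROVES the Yang–Mills mass gap, `NT`, or any item of the route: this is a free-field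
witness that the deciding crux is weaker than the sub-statement.
-/

open scoped SchwartzMap BigOperators Topology
open MeasureTheory Filter Topology Matrix Metric Set
open Literature.MathematicalPhysics.AQFT Literature.MathematicalPhysics.QuantumLattice

noncomputable section

namespace Summit.QuantumFields.YangMills.Cruxes.FiniteRankMirrorFloor.Rung
open Summit.QuantumFields.YangMills.Theorems.SelfNormalisedSkewness.Negative

/-! ## Kernel algebra: the even ring in closed form -/

/-- `tr K(h)² = 2 tr h² + (tr h)²` for symmetric `h` (the derivation action of `h` on `Λ²ℝ⁴` has
eigenvalues `λ_μ + λ_ν`, `μ < ν`). [folklore] -/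
theorem trace_K_mul_K (h : Matrix (Fin 4) (Fin 4) ℝ) (h10 : h 1 0 = h 0 1) (h20 : h 2 0 = h 0 2)
    (h30 : h 3 0 = h 0 3) (h21 : h 2 1 = h 1 2) (h31 : h 3 1 = h 1 3) (h32 : h 3 2 = h 2 3) :
    (K h * K h).trace = 2 * (h * h).trace + h.trace ^ 2 := by
  simp +decide [Matrix.trace, Matrix.mul_apply, Fin.sum_univ_succ, K, p1, p2, δ, h10, h20, h30, h21,
    h31, h32]
  ring

/-- `hessInvSq` is even. [folklore] -/
theorem hessInvSq_neg (x : E4) : hessInvSq (-x) = hessInvSq x := by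
  ext μ ρ
  simp [hessInvSq, nsq]

/-- `tr (∂∂|x|⁻²)² = 48 / |x|⁸` (junk-consistent at `x = 0`). [folklore] -/
theorem trace_hessInvSq_sq (x : E4) : (hessInvSq x * hessInvSq x).trace = 48 / nsq x ^ 4 := by
  by_cases h0 : nsq x = 0
  · have hz : hessInvSq x = 0 := by
      ext μ ρ; simp [hessInvSq, h0]
    simp [hz, h0]
  · have hn : nsq x = x 0 ^ 2 + x 1 ^ 2 + x 2 ^ 2 + x 3 ^ 2 := by
      simp [nsq, Fin.sum_univ_four]
    simp only [Matrix.trace, Matrix.diag, Matrix.mul_apply, Fin.sum_univ_four, hessInvSq, δ]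
    simp +decide only [Fin.isValue, if_true, if_false]
    field_simp
    rw [hn]
    ring

/-- **The free-Maxwell even ring in closed form**: `tr G(z)G(−z) = 96/|z|⁸`. [folklore] -/
theorem trace_maxwellKernel_mul (z : E4) :
    (maxwellKernel z * maxwellKernel (-z)).trace = 96 / nsq z ^ 4 := by
  rw [maxwellKernel, maxwellKernel, hessInvSq_neg]
  have hs := hessInvSq_isSymm z
  rw [trace_K_mul_K _ (hs.apply 0 1) (hs.apply 0 2) (hs.apply 0 3) (hs.apply 1 2) (hs.apply 1 3)
    (hs.apply 2 3), hessInvSq_trace, trace_hessInvSq_sq]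
  ring

/-! ## The scalar density `k(z) = 96/|z|⁸` and its two-sided bounds on the mirror window -/

theorem nsq_eq_norm_sq (z : E4) : nsq z = ‖z‖ ^ 2 := by
  rw [EuclideanSpace.real_norm_sq_eq]; rfl

theorem nsq_nonneg (z : E4) : 0 ≤ nsq z := by
  rw [nsq_eq_norm_sq]; positivity

/-- The scalar even-ring density `k(z) = tr G(z)G(−z) = 96/|z|⁸` (junk `0` at `z = 0`). [folklore] -/
def kρ (z : E4) : ℝ := 96 / nsq z ^ 4

theorem kρ_nonneg (z : E4) : 0 ≤ kρ z := by
  unfold kρ; have := nsq_nonneg z; positivity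

theorem trace_ring_eq_kρ (x y : E4) :
    (maxwellKernel (x - y) * maxwellKernel (y - x)).trace = kρ (x - y) := by
  have h : y - x = -(x - y) := (neg_sub x y).symm
  rw [h, trace_maxwellKernel_mul, kρ]

theorem kρ_lower {z : E4} {D : ℝ} (hz : 0 < ‖z‖) (hD : ‖z‖ ≤ D) : 96 / (D ^ 2) ^ 4 ≤ kρ z := by
  unfold kρ; rw [nsq_eq_norm_sq]
  have h0 : 0 ≤ ‖z‖ := norm_nonneg z
  exact div_le_div_of_nonneg_left (by norm_num) (by positivity) (by gcongr)

theorem kρ_upper {z : E4} {d : ℝ} (hd : 0 < d) (hz : d ≤ ‖z‖) : kρ z ≤ 96 / (d ^ 2) ^ 4 := by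
  unfold kρ; rw [nsq_eq_norm_sq]
  have h0 : 0 ≤ d := hd.le
  exact div_le_div_of_nonneg_left (by norm_num) (by positivity) (by gcongr)

theorem continuous_nsq : Continuous (nsq : E4 → ℝ) := by
  have : (nsq : E4 → ℝ) = fun z => ‖z‖ ^ 2 := funext nsq_eq_norm_sq
  rw [this]; fun_prop

theorem measurable_kρ : Measurable (kρ : E4 → ℝ) := by
  have : (kρ : E4 → ℝ) = fun z => 96 / nsq z ^ 4 := rfl
  rw [this]
  exact measurable_const.div (continuous_nsq.measurable.pow_const 4)

theorem abs_apply_le_norm (z : E4) (i : Fin 4) : |z i| ≤ ‖z‖ := by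
  simpa [Real.norm_eq_abs] using PiLp.norm_apply_le z i

/-! ## The bump mode at scale `ℓ`: centre `(ℓ/2)e₀`, radii `ℓ/8 < ℓ/4` -/

/-- Centre of the mode at scale `ℓ`. [this route] -/
def ctr (ℓ : ℝ) : E4 := (ℓ / 2) • e₀

@[simp] theorem ctr_apply_zero (ℓ : ℝ) : ctr ℓ 0 = ℓ / 2 := by
  simp [ctr, e₀]

theorem norm_e₀ : ‖e₀‖ = 1 := by
  have h : ‖e₀‖ ^ 2 = 1 := by
    rw [EuclideanSpace.real_norm_sq_eq]; simp [e₀]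
  have h' : ‖e₀‖ ^ 2 = 1 ^ 2 := by rw [h, one_pow]
  exact (pow_left_inj₀ (norm_nonneg e₀) zero_le_one two_ne_zero).1 h'

theorem norm_ctr {ℓ : ℝ} (hℓ : 0 ≤ ℓ) : ‖ctr ℓ‖ = ℓ / 2 := by
  rw [ctr, norm_smul, norm_e₀, Real.norm_of_nonneg (by linarith), mul_one]

/-- The smooth bump at scale `ℓ`: `= 1` on `B̄(c_ℓ, ℓ/8)`, supported in `B̄(c_ℓ, ℓ/4)`. [this route] -/
def bump (ℓ : ℝ) (hℓ : 0 < ℓ) : ContDiffBump (ctr ℓ) :=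
  ⟨ℓ / 8, ℓ / 4, by positivity, by linarith⟩

@[simp] theorem bump_rIn (ℓ : ℝ) (hℓ : 0 < ℓ) : (bump ℓ hℓ).rIn = ℓ / 8 := rfl
@[simp] theorem bump_rOut (ℓ : ℝ) (hℓ : 0 < ℓ) : (bump ℓ hℓ).rOut = ℓ / 4 := rfl

/-- The mode as a Schwartz test function (`J = 1`). [this route] -/
def wfun (ℓ : ℝ) (hℓ : 0 < ℓ) : 𝓢(E4, ℝ) :=
  (bump ℓ hℓ).hasCompactSupport.toSchwartzMap (bump ℓ hℓ).contDiff

@[simp] theorem wfun_apply (ℓ : ℝ) (hℓ : 0 < ℓ) (x : E4) : wfun ℓ hℓ x = bump ℓ hℓ x := rfl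

section Geometry

variable {ℓ : ℝ}

theorem time_lower_of_mem {x : E4} (hx : x ∈ closedBall (ctr ℓ) (ℓ / 4)) : ℓ / 4 ≤ x 0 := by
  rw [mem_closedBall, dist_eq_norm] at hx
  have h1 : |(x - ctr ℓ) 0| ≤ ‖x - ctr ℓ‖ := abs_apply_le_norm _ 0
  have h2 : (x - ctr ℓ) 0 = x 0 - ℓ / 2 := by simp
  rw [h2] at h1
  have := (abs_le.mp (h1.trans hx)).1
  linarith

theorem norm_le_of_mem (hℓ : 0 < ℓ) {x : E4} (hx : x ∈ closedBall (ctr ℓ) (ℓ / 4)) : ‖x‖ ≤ 3 * ℓ / 4 := by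
  rw [mem_closedBall, dist_eq_norm] at hx
  have hc : ‖ctr ℓ‖ = ℓ / 2 := norm_ctr hℓ.le
  calc ‖x‖ = ‖(x - ctr ℓ) + ctr ℓ‖ := by rw [sub_add_cancel]
    _ ≤ ‖x - ctr ℓ‖ + ‖ctr ℓ‖ := norm_add_le _ _
    _ ≤ ℓ / 4 + ℓ / 2 := add_le_add hx hc.le
    _ = 3 * ℓ / 4 := by ring

/-- On the mirror window (`x` in the bump's support ball, `θy` in it too) the density is pinched:
`96/(3ℓ/2)⁸ ≤ k(x−y) ≤ 96/(ℓ/2)⁸`. [this route] -/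
theorem kρ_window (hℓ : 0 < ℓ) {x y : E4} (hx : x ∈ closedBall (ctr ℓ) (ℓ / 4))
    (hy : timeReflection 4 y ∈ closedBall (ctr ℓ) (ℓ / 4)) :
    96 / ((3 * ℓ / 2) ^ 2) ^ 4 ≤ kρ (x - y) ∧ kρ (x - y) ≤ 96 / ((ℓ / 2) ^ 2) ^ 4 := by
  have hx0 := time_lower_of_mem hx
  have hy0 : ℓ / 4 ≤ -y 0 := by
    have := time_lower_of_mem hy
    simpa using this
  have hxn := norm_le_of_mem hℓ hx
  have hyn : ‖y‖ ≤ 3 * ℓ / 4 := by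
    have := norm_le_of_mem hℓ hy
    rwa [LinearIsometryEquiv.norm_map] at this
  have hz0 : ℓ / 2 ≤ ‖x - y‖ := by
    have h1 : |(x - y) 0| ≤ ‖x - y‖ := abs_apply_le_norm _ 0
    have h2 : (x - y) 0 = x 0 - y 0 := by simp
    rw [h2] at h1
    have : ℓ / 2 ≤ x 0 - y 0 := by linarith
    exact (this.trans (le_abs_self _)).trans h1
  have hzpos : 0 < ‖x - y‖ := lt_of_lt_of_le (by positivity) hz0
  have hzup : ‖x - y‖ ≤ 3 * ℓ / 2 := (norm_sub_le x y).trans (by linarith)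
  exact ⟨kρ_lower hzpos hzup, kρ_upper (by positivity) hz0⟩

/-- Reflected balls: `y ∈ B̄(θc, r) ↔ θy ∈ B̄(c, r)`. [folklore] -/
theorem mem_reflBall {y c : E4} {r : ℝ} :
    y ∈ closedBall (timeReflection 4 c) r ↔ timeReflection 4 y ∈ closedBall c r := by
  rw [mem_closedBall, mem_closedBall, ← (timeReflection 4).dist_map y, timeReflection_timeReflection]

theorem integrable_indicator_closedBall (c : E4) (r C : ℝ) :
    Integrable ((closedBall c r).indicator fun _ : E4 => C) := by
  refine IntegrableOn.integrable_indicator ?_ measurableSet_closedBall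
  exact integrableOn_const (measure_closedBall_lt_top).ne

/-- Volumes of balls of radius `r`: `r⁴ · vol B(0,1)`. [folklore] -/
theorem volume_real_closedBall (c : E4) {r : ℝ} (hr : 0 ≤ r) :
    (volume : Measure E4).real (closedBall c r) = r ^ 4 * (volume : Measure E4).real (ball 0 1) := by
  rw [Measure.addHaar_real_closedBall volume c hr, finrank_euclideanSpace_fin]

end Geometry

section Scale

variable {ℓ : ℝ} (hℓ : 0 < ℓ)

/-- The two-point density of the model against the reflected mode: `w(θy) k(x−y)`. [this route] -/
def dens2 (x y : E4) : ℝ := bump ℓ hℓ (timeReflection 4 y) * kρ (x - y)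

theorem dens2_nonneg (x y : E4) : 0 ≤ dens2 hℓ x y :=
  mul_nonneg ((bump ℓ hℓ).nonneg' _) (kρ_nonneg _)

/-- Domination of the density on the window by a constant times the indicator of the reflected
support ball. [this route] -/
theorem dens2_le {x : E4} (hx : x ∈ closedBall (ctr ℓ) (ℓ / 4)) (y : E4) :
    ‖dens2 hℓ x y‖ ≤
      (closedBall (timeReflection 4 (ctr ℓ)) (ℓ / 4)).indicator (fun _ => 96 / ((ℓ / 2) ^ 2) ^ 4) y := by
  rw [Real.norm_of_nonneg (dens2_nonneg hℓ x y)]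
  by_cases hy : y ∈ closedBall (timeReflection 4 (ctr ℓ)) (ℓ / 4)
  · rw [indicator_of_mem hy]
    have hy' := (mem_reflBall).1 hy
    unfold dens2
    calc bump ℓ hℓ (timeReflection 4 y) * kρ (x - y) ≤ 1 * (96 / ((ℓ / 2) ^ 2) ^ 4) :=
          mul_le_mul (bump ℓ hℓ).le_one (kρ_window hℓ hx hy').2 (kρ_nonneg _) zero_le_one
      _ = _ := one_mul _
  · rw [indicator_of_notMem hy]
    have hy' : timeReflection 4 y ∉ closedBall (ctr ℓ) (ℓ / 4) := fun h => hy (mem_reflBall.2 h)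
    unfold dens2
    have hb : bump ℓ hℓ (timeReflection 4 y) = 0 :=
      (bump ℓ hℓ).zero_of_le_dist (by rw [mem_closedBall, not_le] at hy'; exact hy'.le)
    rw [hb, zero_mul]

theorem measurable_dens2_uncurry : Measurable (Function.uncurry (dens2 hℓ)) := by
  have h1 : Measurable fun p : E4 × E4 => bump ℓ hℓ (timeReflection 4 p.2) :=
    ((bump ℓ hℓ).continuous.comp ((timeReflection 4).continuous.comp continuous_snd)).measurable
  have h2 : Measurable fun p : E4 × E4 => kρ (p.1 - p.2) :=
    measurable_kρ.comp (measurable_fst.sub measurable_snd)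
  exact h1.mul h2

theorem measurable_dens2 (x : E4) : Measurable (dens2 hℓ x) := by
  have h1 : Measurable fun y : E4 => bump ℓ hℓ (timeReflection 4 y) :=
    ((bump ℓ hℓ).continuous.comp (timeReflection 4).continuous).measurable
  have h2 : Measurable fun y : E4 => kρ (x - y) :=
    measurable_kρ.comp (measurable_const.sub measurable_id)
  exact h1.mul h2

/-- For `x` in the support ball the density is integrable in `y`. [this route] -/
theorem integrable_dens2 {x : E4} (hx : x ∈ closedBall (ctr ℓ) (ℓ / 4)) :
    Integrable (dens2 hℓ x) :=
  Integrable.mono' (integrable_indicator_closedBall _ _ _) (measurable_dens2 hℓ x).aestronglyMeasurable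
    (Eventually.of_forall (dens2_le hℓ hx))

/-- The smeared density `I(x) = ∫ w(θy) k(x−y) dy`. [this route] -/
def innerI (x : E4) : ℝ := ∫ y, dens2 hℓ x y

theorem innerI_nonneg (x : E4) : 0 ≤ innerI hℓ x :=
  integral_nonneg (dens2_nonneg hℓ x)

theorem innerI_le {x : E4} (hx : x ∈ closedBall (ctr ℓ) (ℓ / 4)) :
    ‖innerI hℓ x‖ ≤ 96 / ((ℓ / 2) ^ 2) ^ 4 * (volume : Measure E4).real
      (closedBall (timeReflection 4 (ctr ℓ)) (ℓ / 4)) := by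
  unfold innerI
  calc ‖∫ y, dens2 hℓ x y‖
        ≤ ∫ y, (closedBall (timeReflection 4 (ctr ℓ)) (ℓ / 4)).indicator
            (fun _ => 96 / ((ℓ / 2) ^ 2) ^ 4) y :=
        norm_integral_le_of_norm_le (integrable_indicator_closedBall _ _ _)
          (Eventually.of_forall (dens2_le hℓ hx))
    _ = _ := by
        rw [integral_indicator_const _ measurableSet_closedBall, smul_eq_mul, mul_comm]

/-- The inner floor: for `x` in the INNER ball (`w = 1` there) the smeared density is at least
`k_min · vol B̄(θc, ℓ/8)`. [this route] -/
theorem innerI_ge {x : E4} (hx : x ∈ closedBall (ctr ℓ) (ℓ / 8)) :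
    96 / ((3 * ℓ / 2) ^ 2) ^ 4 * (volume : Measure E4).real
      (closedBall (timeReflection 4 (ctr ℓ)) (ℓ / 8)) ≤ innerI hℓ x := by
  have hx4 : x ∈ closedBall (ctr ℓ) (ℓ / 4) := closedBall_subset_closedBall (by linarith) hx
  unfold innerI
  calc 96 / ((3 * ℓ / 2) ^ 2) ^ 4 * (volume : Measure E4).real
          (closedBall (timeReflection 4 (ctr ℓ)) (ℓ / 8))
        = ∫ y, (closedBall (timeReflection 4 (ctr ℓ)) (ℓ / 8)).indicator
            (fun _ => 96 / ((3 * ℓ / 2) ^ 2) ^ 4) y := by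
        rw [integral_indicator_const _ measurableSet_closedBall, smul_eq_mul, mul_comm]
    _ ≤ ∫ y, dens2 hℓ x y := by
        refine integral_mono (integrable_indicator_closedBall _ _ _) (integrable_dens2 hℓ hx4)
          fun y => ?_
        by_cases hy : y ∈ closedBall (timeReflection 4 (ctr ℓ)) (ℓ / 8)
        · rw [indicator_of_mem hy]
          have hy' := (mem_reflBall).1 hy
          have hy4 : timeReflection 4 y ∈ closedBall (ctr ℓ) (ℓ / 4) :=
            closedBall_subset_closedBall (by linarith) hy'
          have hb : bump ℓ hℓ (timeReflection 4 y) = 1 :=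
            (bump ℓ hℓ).one_of_mem_closedBall (by simpa using hy')
          show _ ≤ dens2 hℓ x y
          unfold dens2
          rw [hb, one_mul]
          exact (kρ_window hℓ hx4 hy4).1
        · rw [indicator_of_notMem hy]
          exact dens2_nonneg hℓ x y

/-- The outer integrand `w(x) I(x)`. [this route] -/
def outerF (x : E4) : ℝ := bump ℓ hℓ x * innerI hℓ x

theorem outerF_nonneg (x : E4) : 0 ≤ outerF hℓ x :=
  mul_nonneg ((bump ℓ hℓ).nonneg' _) (innerI_nonneg hℓ x)

theorem measurable_outerF : Measurable (outerF hℓ) := by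
  have h1 : Measurable fun x : E4 => bump ℓ hℓ x := (bump ℓ hℓ).continuous.measurable
  have h2 : StronglyMeasurable (innerI hℓ) :=
    StronglyMeasurable.integral_prod_right (f := dens2 hℓ)
      (measurable_dens2_uncurry hℓ).stronglyMeasurable
  exact h1.mul h2.measurable

theorem outerF_le (x : E4) :
    ‖outerF hℓ x‖ ≤ (closedBall (ctr ℓ) (ℓ / 4)).indicator
      (fun _ => 96 / ((ℓ / 2) ^ 2) ^ 4 * (volume : Measure E4).real
        (closedBall (timeReflection 4 (ctr ℓ)) (ℓ / 4))) x := by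
  rw [Real.norm_of_nonneg (outerF_nonneg hℓ x)]
  by_cases hx : x ∈ closedBall (ctr ℓ) (ℓ / 4)
  · rw [indicator_of_mem hx]
    unfold outerF
    have hI : innerI hℓ x ≤ _ := (le_abs_self _).trans ((Real.norm_eq_abs _).symm.le.trans
      (innerI_le hℓ hx))
    calc bump ℓ hℓ x * innerI hℓ x ≤ 1 * innerI hℓ x :=
          mul_le_mul_of_nonneg_right (bump ℓ hℓ).le_one (innerI_nonneg hℓ x)
      _ = innerI hℓ x := one_mul _
      _ ≤ _ := hI
  · rw [indicator_of_notMem hx]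
    unfold outerF
    have hb : bump ℓ hℓ x = 0 :=
      (bump ℓ hℓ).zero_of_le_dist (by rw [mem_closedBall, not_le] at hx; exact hx.le)
    rw [hb, zero_mul]

theorem integrable_outerF : Integrable (outerF hℓ) :=
  Integrable.mono' (integrable_indicator_closedBall _ _ _) (measurable_outerF hℓ).aestronglyMeasurable
    (Eventually.of_forall (outerF_le hℓ))

/-- The outer floor. [this route] -/
theorem integral_outerF_ge :
    96 / ((3 * ℓ / 2) ^ 2) ^ 4 * (volume : Measure E4).real
        (closedBall (timeReflection 4 (ctr ℓ)) (ℓ / 8)) *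
      (volume : Measure E4).real (closedBall (ctr ℓ) (ℓ / 8)) ≤ ∫ x, outerF hℓ x := by
  set M : ℝ := 96 / ((3 * ℓ / 2) ^ 2) ^ 4 * (volume : Measure E4).real
        (closedBall (timeReflection 4 (ctr ℓ)) (ℓ / 8)) with hM
  calc M * (volume : Measure E4).real (closedBall (ctr ℓ) (ℓ / 8))
        = ∫ x, (closedBall (ctr ℓ) (ℓ / 8)).indicator (fun _ => M) x := by
        rw [integral_indicator_const _ measurableSet_closedBall, smul_eq_mul, mul_comm]
    _ ≤ ∫ x, outerF hℓ x := by
        refine integral_mono (integrable_indicator_closedBall _ _ _) (integrable_outerF hℓ)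
          fun x => ?_
        by_cases hx : x ∈ closedBall (ctr ℓ) (ℓ / 8)
        · rw [indicator_of_mem hx]
          have hb : bump ℓ hℓ x = 1 := (bump ℓ hℓ).one_of_mem_closedBall (by simpa using hx)
          show M ≤ outerF hℓ x
          unfold outerF
          rw [hb, one_mul, hM]
          exact innerI_ge hℓ hx
        · rw [indicator_of_notMem hx]
          exact outerF_nonneg hℓ x

/-- `maxwellRing2` of the mode is the outer integral (Wick form ↔ density form). [this route] -/
theorem maxwellRing2_wfun : maxwellRing2 (wfun ℓ hℓ) = ∫ x, outerF hℓ x := by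
  unfold maxwellRing2
  refine integral_congr_ae (Eventually.of_forall fun x => ?_)
  show (∫ y, wfun ℓ hℓ x * thetaTest 4 (wfun ℓ hℓ) y *
      (maxwellKernel (x - y) * maxwellKernel (y - x)).trace) = outerF hℓ x
  unfold outerF innerI
  rw [← integral_const_mul]
  refine integral_congr_ae (Eventually.of_forall fun y => ?_)
  show wfun ℓ hℓ x * thetaTest 4 (wfun ℓ hℓ) y *
      (maxwellKernel (x - y) * maxwellKernel (y - x)).trace = bump ℓ hℓ x * dens2 hℓ x y
  rw [thetaTest_apply, wfun_apply, wfun_apply, trace_ring_eq_kρ, dens2]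
  ring

/-- Support properties of the mode. [this route] -/
theorem wfun_tsupport_pos : tsupport (wfun ℓ hℓ : E4 → ℝ) ⊆ {y | 0 < y 0} := by
  intro x hx
  change x ∈ tsupport (bump ℓ hℓ) at hx
  rw [(bump ℓ hℓ).tsupport_eq, bump_rOut] at hx
  have := time_lower_of_mem hx
  show 0 < x 0
  linarith

theorem wfun_tsupport_ball : tsupport (wfun ℓ hℓ : E4 → ℝ) ⊆ closedBall 0 ℓ := by
  intro x hx
  change x ∈ tsupport (bump ℓ hℓ) at hx
  rw [(bump ℓ hℓ).tsupport_eq, bump_rOut] at hx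
  rw [mem_closedBall, dist_zero_right]
  have := norm_le_of_mem hℓ hx
  linarith

theorem wfun_abs_le (z : E4) : |wfun ℓ hℓ z| ≤ 1 := by
  rw [wfun_apply]
  exact abs_le.2 ⟨by linarith [(bump ℓ hℓ).nonneg' z], (bump ℓ hℓ).le_one⟩

theorem wfun_nonneg (z : E4) : 0 ≤ wfun ℓ hℓ z := (bump ℓ hℓ).nonneg' z

end Scale

/-! ## The rung -/

/-- The `ℓ`-free floor constant `κ = 2 · 96/(3/2)⁸ · (vol B(0,1)/8⁴)²`. [this route] -/
def κMxw : ℝ :=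
  2 * (96 / (((3 : ℝ) / 2) ^ 2) ^ 4 * ((1 / 8 : ℝ) ^ 4 * (volume : Measure E4).real (ball 0 1)) *
    ((1 / 8 : ℝ) ^ 4 * (volume : Measure E4).real (ball 0 1)))

theorem volume_real_unitBall_pos : 0 < (volume : Measure E4).real (ball 0 1) := by
  rw [measureReal_def]
  exact ENNReal.toReal_pos (measure_ball_pos volume (0 : E4) one_pos).ne' measure_ball_lt_top.ne

theorem κMxw_pos : 0 < κMxw := by
  have hV := volume_real_unitBall_pos
  have h8 : (0:ℝ) < (1 / 8 : ℝ) ^ 4 * (volume : Measure E4).real (ball 0 1) :=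
    mul_pos (by positivity) hV
  unfold κMxw
  exact mul_pos two_pos (mul_pos (mul_pos (by positivity) h8) h8)

/-- **The free-Maxwell mirror floor (C's analogue, `J = 1`, `p = 0`)**: one sup-normalised
positive-time mode per scale, supported in `{x₀ > 0} ∩ B̄(0, ℓ)`, has Wick mirror form
`MF^{Mxw}(w_ℓ) = 2·maxwellRing2 w_ℓ ≥ κ` with `κ > 0` independent of `ℓ` — at EVERY scale `ℓ > 0`
(hyperscaling saturated: no `ℓ^p` slack). [this route] -/
theorem freeMaxwell_mirrorFloor :
    ∃ κ : ℝ, 0 < κ ∧ ∀ ℓ : ℝ, 0 < ℓ →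
      ∃ w : 𝓢(E4, ℝ), tsupport (w : E4 → ℝ) ⊆ {y | 0 < y 0} ∧
        tsupport (w : E4 → ℝ) ⊆ closedBall 0 ℓ ∧ (∀ z, 0 ≤ w z ∧ w z ≤ 1) ∧
        κ ≤ 2 * maxwellRing2 w := by
  refine ⟨κMxw, κMxw_pos, fun ℓ hℓ => ⟨wfun ℓ hℓ, wfun_tsupport_pos hℓ, wfun_tsupport_ball hℓ,
    fun z => ⟨wfun_nonneg hℓ z, (bump ℓ hℓ).le_one⟩, ?_⟩⟩
  rw [maxwellRing2_wfun hℓ]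
  have h := integral_outerF_ge hℓ
  rw [volume_real_closedBall _ (by positivity : (0:ℝ) ≤ ℓ / 8),
    volume_real_closedBall _ (by positivity : (0:ℝ) ≤ ℓ / 8)] at h
  have hκ : κMxw = 2 * (96 / ((3 * ℓ / 2) ^ 2) ^ 4 *
      ((ℓ / 8) ^ 4 * (volume : Measure E4).real (ball 0 1)) *
      ((ℓ / 8) ^ 4 * (volume : Measure E4).real (ball 0 1))) := by
    unfold κMxw
    have hℓ0 : ℓ ≠ 0 := hℓ.ne'
    field_simp
  rw [hκ]
  linarith

/-- **The rung in the exact quantifier shape of the crux's floor clause** (`FiniteRankMirrorFloor`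
with `MF_{β,L}` replaced by its free-Maxwell Wick value `2·maxwellRing2`, the `β, L` limits being
absent in the continuum model): `J = 1`, `p = 0 < 8`. [this route] -/
theorem freeMaxwell_finiteRankMirrorFloor :
    ∃ (J : ℕ) (p κ : ℝ), p < 8 ∧ 0 < κ ∧ ∀ ℓ₁ : ℝ, 0 < ℓ₁ →
      ∃ (ℓ : ℝ) (v : Fin J → 𝓢(E4, ℝ)), 0 < ℓ ∧ ℓ < ℓ₁ ∧
        (∀ j, tsupport (v j : E4 → ℝ) ⊆ {y | 0 < y 0} ∧
          tsupport (v j : E4 → ℝ) ⊆ closedBall 0 ℓ ∧ ∀ z, |v j z| ≤ 1) ∧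
        κ * ℓ ^ p ≤ ∑ j, 2 * maxwellRing2 (v j) := by
  obtain ⟨κ, hκ, h⟩ := freeMaxwell_mirrorFloor
  refine ⟨1, 0, κ, by norm_num, hκ, fun ℓ₁ hℓ₁ => ?_⟩
  obtain ⟨w, h1, h2, h3, h4⟩ := h (ℓ₁ / 2) (by positivity)
  refine ⟨ℓ₁ / 2, fun _ => w, by positivity, by linarith, fun _ => ⟨h1, h2, fun z =>
    abs_le.2 ⟨by linarith [(h3 z).1], (h3 z).2⟩⟩, ?_⟩
  simpa using h4

/-! ## The separation: S's analogue is FALSE in the same model -/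

/-- **NT clause (ii) fails in the free Maxwell model**: the connected three-point functional of the
Wick square (`κ₃ = 8·maxwellRing3`, tree `maxwellRing3_eq_zero`) admits NO floor `ε > 0`, for any
triple of test functions whatsoever — while the mirror floor above (clause-(i) side, = X₁'s
analogue) holds.  A model deciding C's analogue TRUE and S's analogue FALSE. [this route] -/
theorem freeMaxwell_NT_clauseII_false :
    ¬ ∃ (f g h : 𝓢(E4, ℝ)) (ε : ℝ), 0 < ε ∧ ε ≤ |8 * maxwellRing3 f g h| := by
  rintro ⟨f, g, h, ε, hε, hle⟩
  rw [maxwellRing3_eq_zero] at hle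
  norm_num at hle
  linarith

/-- The separation packaged: C-analogue ∧ ¬ S-analogue in one decided model. [this route] -/
theorem freeMaxwell_separates :
    (∃ κ : ℝ, 0 < κ ∧ ∀ ℓ : ℝ, 0 < ℓ → ∃ w : 𝓢(E4, ℝ), tsupport (w : E4 → ℝ) ⊆ {y | 0 < y 0} ∧
        tsupport (w : E4 → ℝ) ⊆ closedBall 0 ℓ ∧ (∀ z, 0 ≤ w z ∧ w z ≤ 1) ∧
        κ ≤ 2 * maxwellRing2 w) ∧
    ¬ ∃ (f g h : 𝓢(E4, ℝ)) (ε : ℝ), 0 < ε ∧ ε ≤ |8 * maxwellRing3 f g h| :=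
  ⟨freeMaxwell_mirrorFloor, freeMaxwell_NT_clauseII_false⟩

end Summit.QuantumFields.YangMills.Cruxes.FiniteRankMirrorFloor.Rung

end
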